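import Summits.CriticalPhenomena.PercolationContinuityZ3.Theorems.PercNearOneGluingNoHeavyConstsMDLXJoint
import Summits.CriticalPhenomena.PercolationContinuityZ3.Theorems.PercNearOneGluingNoHeavyLowerTailCSHDefs
import Literature.Probability.LatticeModels.ProdBernoulliWeightContinuity
import HarnessLib

/-!
# `p_k ≤ p̂_k` at every level of the conditioned slack hierarchy (PAPER-2 track (ii): constants of the CSH family)

builds on p205010 (kernel theorem, internal audit signed; external expert review pending).  Support file (`--supports
stmt-CriticalPhenomena-4575`), seat `prim-consts-2`; rows A6/A11 of `run/shared/lean/prim/consts/CONSTANTS.md`; answers prim-paper-s3 g70's ask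
("the one-line generalisation of `Consts.jointObserverConst_ge` with the `D`-event `{s ↮ X'}` for an arbitrary `X'` — it gives `p_k ≤ p̂_k` at EVERY
level `k`").  No definitions, no named facts, no sorries.

* `Consts.jointObserverConst_ge_of_subset` — for ANY two vertex sets `X` (avoided by the observer `y`) and `X'`:
  `μ(𝒜 ∩ W) · μ(𝒜 ∩ D') ≤ μ(𝒜) · μ(𝒜 ∩ D' ∩ W)`, `𝒜 = {y ↮ {s} ∪ X}`, `W = {y ↔ z}`, `D' = {s ↮ X'}`, i.e.
  `P(y ↔ z | y ↮ {s} ∪ X) ≤ P(y ↔ z | y ↮ {s} ∪ X, s ↮ X')` (`Consts.jointObserverConst_ge` is `X' = X`).  Same proof: van den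
  Berg–Häggström–Kahn's Theorem 1.4 with the vertex sets `{y}` and `{s} ∪ X`, `1{s ↔ X'}` being increasing and read on the cluster of `{s} ∪ X`.
* `Consts.obsConst_le_jointObsConst` — at level `k` of the hierarchy (owner `x`, avoided set `Y`, decoys `D`, observers `o, v`) the tree's observer
  constant `p_k = CSH.obsConst w o v ({x} ∪ Y ∪ D) = P(o ∈ C_v | v ↮ {x} ∪ Y ∪ D)` is at most the jointly-conditioned
  `p̂_k = P(o ∈ C_v | v ↮ {x} ∪ Y ∪ D, x ↮ Y)` of `Consts.CSHObsJoint` (non-degenerate weights, `v ∉ {x} ∪ Y ∪ D`, `x ∉ Y`).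
[cite: VandenbergHaggstromKahn2005, Thm. 1.4 (p. 7) with Remark 1 after Thm. 1.2 (p. 5); Thm. 2.1 (p. 9) at q = 1]
-/

noncomputable section

namespace Summit.CriticalPhenomena.PercolationContinuityZ3.Theorems

open MeasureTheory Set Literature.Probability.LatticeModels Literature.Probability.Percolation
open scoped Classical

namespace Consts

variable {V : Type*} [Fintype V]

/-- **`P(y ↔ z | y ↮ {s} ∪ X) ≤ P(y ↔ z | y ↮ {s} ∪ X, s ↮ X')` for arbitrary `X, X'`**, denominator-free:
`μ(𝒜 ∩ W) · μ(𝒜 ∩ D') ≤ μ(𝒜) · μ(𝒜 ∩ D' ∩ W)` with `𝒜 = {y ↮ {s} ∪ X}`, `W = {y ↔ z}`, `D' = {s ↮ X'}`.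
[cite: VandenbergHaggstromKahn2005, Thm. 1.4 (p. 7) with Remark 1 after Thm. 1.2 (p. 5); Thm. 2.1 (p. 9) at q = 1] -/
theorem jointObserverConst_ge_of_subset (w : Sym2 V → unitInterval) (s y z : V) (X X' : Set V) :
    (prodBernoulli w).real ({ω : BondConfig V | ∀ x ∈ insert s X, ¬ (openGraph ω).Reachable y x} ∩ openConn y z) *
      (prodBernoulli w).real ({ω : BondConfig V | ∀ x ∈ insert s X, ¬ (openGraph ω).Reachable y x} ∩
        {ω | ∀ x ∈ X', ¬ (openGraph ω).Reachable s x}) ≤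
    (prodBernoulli w).real {ω : BondConfig V | ∀ x ∈ insert s X, ¬ (openGraph ω).Reachable y x} *
      (prodBernoulli w).real ({ω : BondConfig V | ∀ x ∈ insert s X, ¬ (openGraph ω).Reachable y x} ∩
        {ω | ∀ x ∈ X', ¬ (openGraph ω).Reachable s x} ∩ openConn y z) := by
  classical
  set μ := prodBernoulli w with hμ
  set 𝒜 : Set (BondConfig V) := {ω | ∀ x ∈ insert s X, ¬ (openGraph ω).Reachable y x} with h𝒜
  set W : Set (BondConfig V) := openConn y z with hW
  set D : Set (BondConfig V) := {ω | ∀ x ∈ X', ¬ (openGraph ω).Reachable s x} with hD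
  set J : Set (BondConfig V) := {ω | ∃ x ∈ X', (openGraph ω).Reachable s x} with hJ
  have h𝒜' : {ω : BondConfig V | ∀ a ∈ ({y} : Set V), ∀ t ∈ insert s X, ¬ (openGraph ω).Reachable a t} = 𝒜 := by
    ext ω
    simp only [h𝒜, mem_setOf_eq, mem_singleton_iff, forall_eq]
  set F : Set (Sym2 V) → ℝ := connIndicatorFn y z with hF
  set G : Set (Sym2 V) → ℝ := fun C => if (∃ x ∈ X', (openGraph C).Reachable s x) then (1 : ℝ) else 0 with hG
  have hFm : Monotone F := monotone_connIndicatorFn y z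
  have hGm : Monotone G := by
    refine TripodExchange.predIndicator_monotone ?_
    rintro C C' hCC' ⟨x, hx, hr⟩
    exact ⟨x, hx, hr.mono (openGraph_mono hCC')⟩
  have hFω : ∀ ω : BondConfig V, F (⋃ a ∈ ({y} : Set V), openEdgeCluster ω a) = W.indicator 1 ω := by
    intro ω
    have : (⋃ a ∈ ({y} : Set V), openEdgeCluster ω a) = openEdgeCluster ω y := by
      ext e; simp
    rw [this, hF, connIndicatorFn_openEdgeCluster]
  have hGω : ∀ ω : BondConfig V, G (⋃ t ∈ insert s X, openEdgeCluster ω t) = J.indicator 1 ω := by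
    intro ω
    have hiff : (∃ x ∈ X', (openGraph (⋃ t ∈ insert s X, openEdgeCluster ω t)).Reachable s x) ↔
        ∃ x ∈ X', (openGraph ω).Reachable s x := by
      constructor
      · rintro ⟨x, hx, hr⟩
        exact ⟨x, hx, (KNSep.reachable_iff_cluster ω (insert s X) (mem_insert s X) x).2 hr⟩
      · rintro ⟨x, hx, hr⟩
        exact ⟨x, hx, (KNSep.reachable_iff_cluster ω (insert s X) (mem_insert s X) x).1 hr⟩
    simp only [hG, hiff]
    exact TwoSetConditionalAssociation.predIndicator_eq_indicator (fun ω' => ∃ x ∈ X', (openGraph ω').Reachable s x) ω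
  have key := BHK2006_twoSetConditionalAssociation.negCorrelation w {y} (insert s X) F G hFm hGm
  simp only [h𝒜', hFω, hGω, TripodExchange.setIntegral_indicator_one_eq,
    TripodExchange.setIntegral_indicator_mul_indicator_eq] at key
  -- key : μ.real 𝒜 * μ.real (𝒜 ∩ (W ∩ J)) ≤ μ.real (𝒜 ∩ W) * μ.real (𝒜 ∩ J)
  have hWD : μ.real (𝒜 ∩ W ∩ D) + μ.real (𝒜 ∩ (W ∩ J)) = μ.real (𝒜 ∩ W) := by
    have h := measureReal_inter_add_sdiff (μ := μ) (s := 𝒜 ∩ W) (MeasurableSet.of_discrete : MeasurableSet D)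
    have hset : (𝒜 ∩ W) \ D = 𝒜 ∩ (W ∩ J) := by
      ext ω
      simp only [hD, hJ, mem_sdiff, mem_inter_iff, mem_setOf_eq, not_forall, not_not, exists_prop]
      tauto
    rwa [hset] at h
  have h𝒜D : μ.real (𝒜 ∩ D) + μ.real (𝒜 ∩ J) = μ.real 𝒜 := by
    have h := measureReal_inter_add_sdiff (μ := μ) (s := 𝒜) (MeasurableSet.of_discrete : MeasurableSet D)
    have hset : 𝒜 \ D = 𝒜 ∩ J := by
      ext ω
      simp only [hD, hJ, mem_sdiff, mem_inter_iff, mem_setOf_eq, not_forall, not_not, exists_prop]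
    rwa [hset] at h
  have hcomm : 𝒜 ∩ D ∩ W = 𝒜 ∩ W ∩ D := inter_right_comm 𝒜 D W
  rw [hcomm]
  have h1 : μ.real (𝒜 ∩ D) = μ.real 𝒜 - μ.real (𝒜 ∩ J) := by linarith
  have h2 : μ.real (𝒜 ∩ W ∩ D) = μ.real (𝒜 ∩ W) - μ.real (𝒜 ∩ (W ∩ J)) := by linarith
  rw [h1, h2]
  nlinarith [key]

/-- **`p_k ≤ p̂_k` at every level.**  Non-degenerate weights; owner `x ∉ Y`, avoided set `Y`, decoys `D`, observers `o` and
`v ∉ {x} ∪ Y ∪ D`.  The tree's observer constant of level `k = |D|`, `CSH.obsConst w o v ({x} ∪ Y ∪ D) = P(o ∈ C_v | v ↮ {x} ∪ Y ∪ D)`, is at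
most the jointly-conditioned one `P(o ∈ C_v | v ↮ {x} ∪ Y ∪ D, x ↮ Y)` of `Consts.CSHObsJoint` / `Consts.MDLXJoint` (`D = []`).
[cite: VandenbergHaggstromKahn2005, Thm. 1.4 (p. 7) with Remark 1 after Thm. 1.2 (p. 5)] -/
theorem obsConst_le_jointObsConst (w : Sym2 V → unitInterval) (hw : ∀ e, 0 < w e ∧ w e < 1) (x : V) (Y : Set V) (D : List V)
    (o v : V) (hx : x ∉ Y) (hv : v ∉ insert x Y ∪ {d | d ∈ D}) :
    CSH.obsConst w o v (insert x Y ∪ {d | d ∈ D}) ≤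
      (prodBernoulli w).real ({ω : BondConfig V | ∀ a ∈ insert x Y ∪ {d | d ∈ D}, ¬ (openGraph ω).Reachable v a} ∩
          {ω | ∀ y ∈ Y, ¬ (openGraph ω).Reachable x y} ∩ openConn o v) /
        (prodBernoulli w).real ({ω : BondConfig V | ∀ a ∈ insert x Y ∪ {d | d ∈ D}, ¬ (openGraph ω).Reachable v a} ∩
          {ω | ∀ y ∈ Y, ¬ (openGraph ω).Reachable x y}) := by
  classical
  set μ := prodBernoulli w with hμ
  -- `insert x Y ∪ D = insert x (Y ∪ D)`
  have hA : insert x Y ∪ {d | d ∈ D} = insert x (Y ∪ {d | d ∈ D}) := by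
    ext u; simp only [mem_union, mem_insert_iff, mem_setOf_eq]; tauto
  have key := jointObserverConst_ge_of_subset w x v o (Y ∪ {d | d ∈ D}) Y
  rw [← hA] at key
  set 𝒜 : Set (BondConfig V) := {ω | ∀ a ∈ insert x Y ∪ {d | d ∈ D}, ¬ (openGraph ω).Reachable v a} with h𝒜
  set Dx : Set (BondConfig V) := {ω | ∀ y ∈ Y, ¬ (openGraph ω).Reachable x y} with hDx
  -- positivity of the two conditioning events (the empty configuration lies in both)
  have hbot : openGraph (∅ : BondConfig V) = ⊥ := by
    unfold openGraph; exact SimpleGraph.fromEdgeSet_empty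
  have hnoreach : ∀ a b : V, a ≠ b → ¬ (openGraph (∅ : BondConfig V)).Reachable a b := fun a b hab h => by
    rw [hbot, SimpleGraph.reachable_bot] at h; exact hab h
  have hempA : (∅ : BondConfig V) ∈ 𝒜 := fun a ha => hnoreach v a (fun h => hv (h ▸ ha))
  have hempD : (∅ : BondConfig V) ∈ Dx := fun y hy => hnoreach x y (fun h => hx (h ▸ hy))
  have h𝒜pos : 0 < μ.real 𝒜 := prodBernoulli_real_pos_of_nonempty hw ⟨∅, hempA⟩
  have h𝒜Dpos : 0 < μ.real (𝒜 ∩ Dx) := prodBernoulli_real_pos_of_nonempty hw ⟨∅, hempA, hempD⟩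
  -- `obsConst = μ(𝒜 ∩ {o ↔ v}) / μ(𝒜)` and `{o ↔ v} = {v ↔ o}`
  have hOV : (openConn o v : Set (BondConfig V)) = openConn v o := KNPreFKG.openConn_symm o v
  unfold CSH.obsConst
  rw [hOV, div_le_div_iff₀ h𝒜pos h𝒜Dpos]
  -- key : μ(𝒜 ∩ W) μ(𝒜 ∩ Dx) ≤ μ(𝒜) μ(𝒜 ∩ Dx ∩ W)
  calc μ.real (𝒜 ∩ openConn v o) * μ.real (𝒜 ∩ Dx)
      ≤ μ.real 𝒜 * μ.real (𝒜 ∩ Dx ∩ openConn v o) := key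
    _ = μ.real (𝒜 ∩ Dx ∩ openConn v o) * μ.real 𝒜 := mul_comm _ _

end Consts

end Summit.CriticalPhenomena.PercolationContinuityZ3.Theorems

end
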